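import Summits.HubbardSuperconductivity.HubbardSuperconductivity.Theorems.AnisotropyChordTransferFibre3C0Perm

/-!
# Route `AnisotropyChord` / H0 rotor rung: PartN41-C §4 — `ShellBulkBound` PROVED (the crude Cauchy–Schwarz shell bound, `L ≥ 3`)

Theory-1 g22's PartN41-C §4 `ShellBulkBound` (port …Fibre3KT2bRow): off the window `shellWin ∪ {0, x̂}` the shell-cancellation form
`C0ShellForm` (`ShellRow.c0_shell_form`) reads ★ `c0_shell_PQRT`:
`C0(x̂,b) = ½[f_nn·(D_x f(b))² − f_nn·Σ_e D_e f(b)D_e f(c) + ξ·(f(c)D_{−x}f(b) + f(b)D_x f(c)) + ζ·(f(c)(D_y+D_{−y})f(b) + f(b)(D_y+D_{−y})f(c))]`,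
`c = b − x̂`, `ξ = f(2x̂) − f_nn`, `ζ = f(x̂+ŷ) − f_nn` (`f` even and x-mirror symmetric, `f(0) = 0`); there every lattice gradient has both
endpoints off the origin, so it is (minus) a gradient of `s = 1 − f` (★ `Dgrad_eq_neg_sgrad`) and its square-sums over any such set are
`≤ τ̄ = ‖∇ₓs‖²` in all four directions (★ `sum_sgrad_sq_dir`, swap symmetry; ★ `sum_Dgrad_sq_le`, `sum_Dgrad_sq_shift_le`).  With
`(u−v+w+z)² ≤ 4(u²+v²+w²+z²)` (inline), `|D f| ≤ δ`, `|f| ≤ M` this gives ★ `shell_bulk_bound`: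
`Σ_{b ∉ shellWin ∪ {0,x̂}} C0(x̂,b)² ≤ (17 f_nn²δ² + 8ξ²M² + 16ζ²M²)·τ̄` (in fact with `4ξ²M²`), and ★ `shellBulkBound_holds (hL : 3 ≤ L) (Δ) :
ShellBulkBound L Δ`.
Prover seat `hubbard-h0-rotor-p1` g27 (route lead); helper for stmt-HubbardSuperconductivity-23918 (`--supports`, helper class).
WHAT THIS IS NOT: nothing here proves superconductivity in the Hubbard model; one crude inequality of ONE row of ONE conditional
reduction.  Tree imports only; no new definitions; no sorry, no axioms.
-/

set_option linter.dupNamespace false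
set_option autoImplicit false

noncomputable section

open scoped BigOperators

namespace Summit.HubbardSuperconductivity.HubbardSuperconductivity.Theorems.AnisotropyChord.Transfer.Fibre3

variable (L : ℕ) [NeZero L]

namespace ShellRow

/-! ## §1 Gradients of `f` off the origin are gradients of `s` -/

omit [NeZero L] in
/-- `D_e f(b) = −(s(b) − s(b − e))` when `b ≠ 0`, `b − e ≠ 0`. [folklore] -/
theorem Dgrad_eq_neg_sgrad (Δ : ℝ) (f : Tor L → ℝ) (e b : Tor L) (hb : b ≠ 0) (hbe : b - e ≠ 0) :
    Dgrad L f e b = -(sfun L Δ f b - sfun L Δ f (b - e)) := by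
  unfold Dgrad sfun
  rw [if_neg hb, if_neg hbe]
  ring

omit [NeZero L] in
/-- the square. [folklore] -/
theorem Dgrad_sq_eq_sgrad_sq (Δ : ℝ) (f : Tor L → ℝ) (e b : Tor L) (hb : b ≠ 0) (hbe : b - e ≠ 0) :
    Dgrad L f e b ^ 2 = (sfun L Δ f b - sfun L Δ f (b - e)) ^ 2 := by
  rw [Dgrad_eq_neg_sgrad L Δ f e b hb hbe, neg_sq]

omit [NeZero L] in
/-- `s` is swap-symmetric when `f` is. [folklore] -/
theorem sfun_sw (Δ : ℝ) {f : Tor L → ℝ} (hsw : ∀ r : Tor L, f (r.2, r.1) = f r) (r : Tor L) :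
    sfun L Δ f (r.2, r.1) = sfun L Δ f r := by
  unfold sfun
  simp only [swap_eq_zero_iff, hsw]

/-! ## §2 `‖D_e s‖² = τ̄` in the four directions -/

/-- `τ̄ = Σ_a (s(a) − s(a − x̂))²`. [folklore] -/
theorem gradNormSq_eq (Δ : ℝ) (f : Tor L → ℝ) :
    gradNormSq L Δ f = ∑ a : Tor L, (sfun L Δ f a - sfun L Δ f (a - ex L)) ^ 2 := rfl

/-- direction `−x̂`. [folklore] -/
theorem sum_sgrad_sq_negx (Δ : ℝ) (f : Tor L → ℝ) :
    ∑ a : Tor L, (sfun L Δ f a - sfun L Δ f (a - -ex L)) ^ 2 = gradNormSq L Δ f := by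
  rw [gradNormSq_eq]
  refine Fintype.sum_equiv (Equiv.addRight (ex L)) _ _ (fun a => ?_)
  rw [Equiv.coe_addRight, sub_neg_eq_add, add_sub_cancel_right]
  ring

/-- direction `ŷ` (swap symmetry). [folklore] -/
theorem sum_sgrad_sq_y (Δ : ℝ) {f : Tor L → ℝ} (hsw : ∀ r : Tor L, f (r.2, r.1) = f r) :
    ∑ a : Tor L, (sfun L Δ f a - sfun L Δ f (a - ey L)) ^ 2 = gradNormSq L Δ f := by
  rw [gradNormSq_eq]
  refine Fintype.sum_equiv (Equiv.prodComm (ZMod L) (ZMod L)) _ _ (fun a => ?_)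
  rw [Equiv.prodComm_apply, Prod.swap]
  have h1 := sfun_sw L Δ hsw a
  have h2 := sfun_sw L Δ hsw (a - ey L)
  have e : (((a - ey L).2, (a - ey L).1) : Tor L) = (a.2, a.1) - ex L := by
    unfold ex ey; ext <;> simp
  rw [e] at h2
  rw [h1, h2]

/-- direction `−ŷ`. [folklore] -/
theorem sum_sgrad_sq_negy (Δ : ℝ) {f : Tor L → ℝ} (hsw : ∀ r : Tor L, f (r.2, r.1) = f r) :
    ∑ a : Tor L, (sfun L Δ f a - sfun L Δ f (a - -ey L)) ^ 2 = gradNormSq L Δ f := by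
  rw [← sum_sgrad_sq_y L Δ hsw]
  refine Fintype.sum_equiv (Equiv.addRight (ey L)) _ _ (fun a => ?_)
  rw [Equiv.coe_addRight, sub_neg_eq_add, add_sub_cancel_right]
  ring

/-- ★ all four directions: for `e ∈ {±x̂, ±ŷ}`, `Σ_a (s(a) − s(a − e))² = τ̄`. [folklore] -/
theorem sum_sgrad_sq_dir (Δ : ℝ) {f : Tor L → ℝ} (hsw : ∀ r : Tor L, f (r.2, r.1) = f r) {e : Tor L}
    (he : e = ex L ∨ e = -ex L ∨ e = ey L ∨ e = -ey L) :
    ∑ a : Tor L, (sfun L Δ f a - sfun L Δ f (a - e)) ^ 2 = gradNormSq L Δ f := by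
  rcases he with h | h | h | h <;> rw [h]
  · rfl
  · exact sum_sgrad_sq_negx L Δ f
  · exact sum_sgrad_sq_y L Δ hsw
  · exact sum_sgrad_sq_negy L Δ hsw

/-! ## §3 Partial square-sums of gradients of `f` off the origin are `≤ τ̄` -/

/-- `Σ_{b ∈ S} (D_e f(b))² ≤ τ̄` if every `b ∈ S` has `b ≠ 0`, `b − e ≠ 0`. [folklore] -/
theorem sum_Dgrad_sq_le (Δ : ℝ) {f : Tor L → ℝ} (hsw : ∀ r : Tor L, f (r.2, r.1) = f r) {e : Tor L}
    (he : e = ex L ∨ e = -ex L ∨ e = ey L ∨ e = -ey L) (S : Finset (Tor L))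
    (hS : ∀ b ∈ S, b ≠ 0 ∧ b - e ≠ 0) :
    ∑ b ∈ S, Dgrad L f e b ^ 2 ≤ gradNormSq L Δ f := by
  rw [← sum_sgrad_sq_dir L Δ hsw he]
  rw [Finset.sum_congr rfl fun b hb => Dgrad_sq_eq_sgrad_sq L Δ f e b (hS b hb).1 (hS b hb).2]
  exact Finset.sum_le_univ_sum_of_nonneg fun b => sq_nonneg _

/-- the same for the shifted site `c = b − x̂`: `Σ_{b ∈ S} (D_e f(b − x̂))² ≤ τ̄` if `b − x̂ ≠ 0`, `b − x̂ − e ≠ 0` on `S`. [folklore] -/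
theorem sum_Dgrad_sq_shift_le (Δ : ℝ) {f : Tor L → ℝ} (hsw : ∀ r : Tor L, f (r.2, r.1) = f r) {e : Tor L}
    (he : e = ex L ∨ e = -ex L ∨ e = ey L ∨ e = -ey L) (S : Finset (Tor L))
    (hS : ∀ b ∈ S, b - ex L ≠ 0 ∧ b - ex L - e ≠ 0) :
    ∑ b ∈ S, Dgrad L f e (b - ex L) ^ 2 ≤ gradNormSq L Δ f := by
  have hmap : ∑ b ∈ S, Dgrad L f e (b - ex L) ^ 2
      = ∑ c ∈ S.map (Equiv.subRight (ex L)).toEmbedding, Dgrad L f e c ^ 2 := by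
    rw [Finset.sum_map]
    rfl
  rw [hmap]
  refine sum_Dgrad_sq_le L Δ hsw he _ (fun c hc => ?_)
  rw [Finset.mem_map] at hc
  obtain ⟨b, hb, hbc⟩ := hc
  have : c = b - ex L := by rw [← hbc]; rfl
  rw [this]
  exact hS b hb

/-! ## §4 The pointwise form and bound off the window -/

/-- membership in the bulk set, unfolded. [folklore] -/
theorem mem_bulk {b : Tor L}
    (hb : b ∈ (((Finset.univ : Finset (Tor L)).erase 0).erase (ex L)) \ shellWin L) :
    b ≠ 0 ∧ b ≠ ex L ∧ b ≠ -ex L ∧ b ≠ ey L ∧ b ≠ -ey L ∧ b ≠ ex L + ex L ∧ b ≠ ex L + ey L ∧ b ≠ ex L - ey L := by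
  classical
  simp only [shellWin, Finset.mem_sdiff, Finset.mem_erase, Finset.mem_univ, Finset.mem_insert,
    Finset.mem_singleton, not_or] at hb
  obtain ⟨⟨h1, h0, -⟩, h2, h3, h4, h5, h6, h7⟩ := hb
  exact ⟨h0, h1, h2, h3, h4, h5, h6, h7⟩

omit [NeZero L] in
/-- `f(x̂ − ŷ) = f(x̂ + ŷ)` for an even, x-mirror-symmetric `f`. [folklore] -/
theorem f_ex_sub_ey {f : Tor L → ℝ} (heven : ∀ r : Tor L, f (-r) = f r) (hmi : ∀ r : Tor L, f (-r.1, r.2) = f r) :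
    f (ex L - ey L) = f (ex L + ey L) := by
  have h1 := hmi (ex L - ey L)
  have e : ((-(ex L - ey L).1, (ex L - ey L).2) : Tor L) = -(ex L + ey L) := by
    unfold ex ey; ext <;> simp
  rw [e, heven] at h1
  exact h1.symm

/-- ★ the shell-cancellation form regrouped as `½(f_nn·P − f_nn·Q + ξ·R + ζ·T)` (even, x-mirror-symmetric two-magnon `f`, `L ≥ 3`). [folklore] -/
theorem c0_shell_PQRT (hL : 3 ≤ L) {Δ lam2 : ℝ} {f : Tor L → ℝ} (hf : IsTwoMagnon L Δ lam2 f)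
    (heven : ∀ r : Tor L, f (-r) = f r) (hmi : ∀ r : Tor L, f (-r.1, r.2) = f r)
    (b : Tor L) (hb0 : b ≠ 0) (hb1 : b ≠ ex L) :
    C0fn L Δ lam2 f (ex L, b)
      = (1 / 2 : ℝ) * (f (ex L) * Dgrad L f (ex L) b ^ 2
          - f (ex L) * (Dgrad L f (ex L) b * Dgrad L f (ex L) (b - ex L)
              + Dgrad L f (-ex L) b * Dgrad L f (-ex L) (b - ex L)
              + Dgrad L f (ey L) b * Dgrad L f (ey L) (b - ex L)
              + Dgrad L f (-ey L) b * Dgrad L f (-ey L) (b - ex L))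
          + xiW L f * (f (b - ex L) * Dgrad L f (-ex L) b + f b * Dgrad L f (ex L) (b - ex L))
          + zetaW L f * (f (b - ex L) * (Dgrad L f (ey L) b + Dgrad L f (-ey L) b)
              + f b * (Dgrad L f (ey L) (b - ex L) + Dgrad L f (-ey L) (b - ex L)))) := by
  obtain ⟨-, ne1, ne2, ne3, ne4, ne5, ne6⟩ := nn_distinct L hL
  have hf0 : f 0 = 0 := hf.1
  have hxy := f_ex_sub_ey L heven hmi
  rw [c0_shell_form L hL hf b hb0 hb1, nnList_map_sum, nnList_map_sum]
  simp only [if_neg ne1, if_neg ne2, if_neg ne3, if_neg ne4, if_neg ne5, if_neg ne6, if_true]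
  unfold Dgrad xiW zetaW
  simp only [sub_neg_eq_add, sub_self, ← sub_eq_add_neg, hf0, hxy]
  ring

/-- `|x| ≤ δ ⇒ x² ≤ δ²`. [folklore] -/
theorem sq_le_sq_of_abs_le {x δ : ℝ} (h : |x| ≤ δ) : x ^ 2 ≤ δ ^ 2 := by
  obtain ⟨h1, h2⟩ := abs_le.mp h
  nlinarith

/-- `x² ≤ y ⇒ (c·x)² ≤ c²·y`. [folklore] -/
theorem sq_mul_le {x y : ℝ} (c : ℝ) (h : x ^ 2 ≤ y) : (c * x) ^ 2 ≤ c ^ 2 * y := by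
  rw [mul_pow]; exact mul_le_mul_of_nonneg_left h (sq_nonneg _)

/-- `x² ≤ d ⇒ (x·q)² ≤ d·q²`. [folklore] -/
theorem sq_mul_le' {x d : ℝ} (q : ℝ) (h : x ^ 2 ≤ d) : (x * q) ^ 2 ≤ d * q ^ 2 := by
  rw [mul_pow]; exact mul_le_mul_of_nonneg_right h (sq_nonneg _)

/-- the `v`-term: `(Σpᵢqᵢ)² ≤ 4δ²Σqᵢ²` when `pᵢ² ≤ δ²`. [folklore] -/
theorem termV_le (δ P1 P2 P3 P4 Q1 Q2 Q3 Q4 : ℝ)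
    (p1 : P1 ^ 2 ≤ δ ^ 2) (p2 : P2 ^ 2 ≤ δ ^ 2) (p3 : P3 ^ 2 ≤ δ ^ 2) (p4 : P4 ^ 2 ≤ δ ^ 2) :
    (P1 * Q1 + P2 * Q2 + P3 * Q3 + P4 * Q4) ^ 2 ≤ 4 * δ ^ 2 * (Q1 ^ 2 + Q2 ^ 2 + Q3 ^ 2 + Q4 ^ 2) := by
  have hQ : (P1 * Q1 + P2 * Q2 + P3 * Q3 + P4 * Q4) ^ 2
      ≤ 4 * ((P1 * Q1) ^ 2 + (P2 * Q2) ^ 2 + (P3 * Q3) ^ 2 + (P4 * Q4) ^ 2) := by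
    linarith [sq_nonneg (P1 * Q1 - P2 * Q2), sq_nonneg (P1 * Q1 - P3 * Q3), sq_nonneg (P1 * Q1 - P4 * Q4),
      sq_nonneg (P2 * Q2 - P3 * Q3), sq_nonneg (P2 * Q2 - P4 * Q4), sq_nonneg (P3 * Q3 - P4 * Q4)]
  have e1 := sq_mul_le' Q1 p1
  have e2 := sq_mul_le' Q2 p2
  have e3 := sq_mul_le' Q3 p3
  have e4 := sq_mul_le' Q4 p4
  linarith

/-- the `w`-term: `(F_c p₂ + F_b q₁)² ≤ 2M²(p₂² + q₁²)` when `F² ≤ M²`. [folklore] -/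
theorem termW_le (M Fb Fc P2 Q1 : ℝ) (fb : Fb ^ 2 ≤ M ^ 2) (fc : Fc ^ 2 ≤ M ^ 2) :
    (Fc * P2 + Fb * Q1) ^ 2 ≤ 2 * M ^ 2 * (P2 ^ 2 + Q1 ^ 2) := by
  have hR : (Fc * P2 + Fb * Q1) ^ 2 ≤ 2 * ((Fc * P2) ^ 2 + (Fb * Q1) ^ 2) := by
    linarith [sq_nonneg (Fc * P2 - Fb * Q1)]
  have e1 := sq_mul_le' P2 fc
  have e2 := sq_mul_le' Q1 fb
  linarith

/-- the `z`-term: `(F_c(p₃+p₄) + F_b(q₃+q₄))² ≤ 4M²(p₃²+p₄²+q₃²+q₄²)` when `F² ≤ M²`. [folklore] -/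
theorem termZ_le (M Fb Fc P3 P4 Q3 Q4 : ℝ) (fb : Fb ^ 2 ≤ M ^ 2) (fc : Fc ^ 2 ≤ M ^ 2) :
    (Fc * (P3 + P4) + Fb * (Q3 + Q4)) ^ 2 ≤ 4 * M ^ 2 * (P3 ^ 2 + P4 ^ 2 + Q3 ^ 2 + Q4 ^ 2) := by
  have hT : (Fc * (P3 + P4) + Fb * (Q3 + Q4)) ^ 2 ≤ 2 * ((Fc * (P3 + P4)) ^ 2 + (Fb * (Q3 + Q4)) ^ 2) := by
    linarith [sq_nonneg (Fc * (P3 + P4) - Fb * (Q3 + Q4))]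
  have e1 := sq_mul_le' (P3 + P4) fc
  have e2 := sq_mul_le' (Q3 + Q4) fb
  have s1 : (P3 + P4) ^ 2 ≤ 2 * (P3 ^ 2 + P4 ^ 2) := by linarith [sq_nonneg (P3 - P4)]
  have s2 : (Q3 + Q4) ^ 2 ≤ 2 * (Q3 ^ 2 + Q4 ^ 2) := by linarith [sq_nonneg (Q3 - Q4)]
  have hM : 0 ≤ M ^ 2 := sq_nonneg _
  have e1' : M ^ 2 * (P3 + P4) ^ 2 ≤ M ^ 2 * (2 * (P3 ^ 2 + P4 ^ 2)) := mul_le_mul_of_nonneg_left s1 hM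
  have e2' : M ^ 2 * (Q3 + Q4) ^ 2 ≤ M ^ 2 * (2 * (Q3 ^ 2 + Q4 ^ 2)) := mul_le_mul_of_nonneg_left s2 hM
  linarith

/-- the pointwise bound as pure algebra: `C = ½(f_nn P₁² − f_nn Σpᵢqᵢ + ξ(F_c p₂ + F_b q₁) + ζ(F_c(p₃+p₄) + F_b(q₃+q₄)))`,
`pᵢ² ≤ δ²`, `F_b², F_c² ≤ M²` ⇒ `C² ≤ f_nn²δ²p₁² + 4f_nn²δ²Σqᵢ² + 2ξ²M²(p₂² + q₁²) + 4ζ²M²(p₃²+p₄²+q₃²+q₄²)`. [folklore] -/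
theorem pointwise_alg (fnn ξ ζ M δ Fb Fc P1 P2 P3 P4 Q1 Q2 Q3 Q4 C : ℝ)
    (hC : C = (1 / 2 : ℝ) * (fnn * P1 ^ 2 - fnn * (P1 * Q1 + P2 * Q2 + P3 * Q3 + P4 * Q4)
      + ξ * (Fc * P2 + Fb * Q1) + ζ * (Fc * (P3 + P4) + Fb * (Q3 + Q4))))
    (p1 : P1 ^ 2 ≤ δ ^ 2) (p2 : P2 ^ 2 ≤ δ ^ 2) (p3 : P3 ^ 2 ≤ δ ^ 2) (p4 : P4 ^ 2 ≤ δ ^ 2)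
    (fb : Fb ^ 2 ≤ M ^ 2) (fc : Fc ^ 2 ≤ M ^ 2) :
    C ^ 2 ≤ fnn ^ 2 * δ ^ 2 * P1 ^ 2 + 4 * fnn ^ 2 * δ ^ 2 * (Q1 ^ 2 + Q2 ^ 2 + Q3 ^ 2 + Q4 ^ 2)
      + 2 * ξ ^ 2 * M ^ 2 * (P2 ^ 2 + Q1 ^ 2) + 4 * ζ ^ 2 * M ^ 2 * (P3 ^ 2 + P4 ^ 2 + Q3 ^ 2 + Q4 ^ 2) := by
  -- `C = ½(u − v + w + z)`, `C² ≤ u² + v² + w² + z²`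
  have h4 : ∀ x₁ x₂ x₃ x₄ : ℝ, (x₁ + x₂ + x₃ + x₄) ^ 2 ≤ 4 * (x₁ ^ 2 + x₂ ^ 2 + x₃ ^ 2 + x₄ ^ 2) :=
    fun x₁ x₂ x₃ x₄ => by
      linarith [sq_nonneg (x₁ - x₂), sq_nonneg (x₁ - x₃), sq_nonneg (x₁ - x₄), sq_nonneg (x₂ - x₃),
        sq_nonneg (x₂ - x₄), sq_nonneg (x₃ - x₄)]
  have h4 := h4 (fnn * P1 ^ 2) (-(fnn * (P1 * Q1 + P2 * Q2 + P3 * Q3 + P4 * Q4)))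
    (ξ * (Fc * P2 + Fb * Q1)) (ζ * (Fc * (P3 + P4) + Fb * (Q3 + Q4)))
  have e : C ^ 2 = (1 / 4 : ℝ) * ((fnn * P1 ^ 2) + -(fnn * (P1 * Q1 + P2 * Q2 + P3 * Q3 + P4 * Q4))
      + ξ * (Fc * P2 + Fb * Q1) + ζ * (Fc * (P3 + P4) + Fb * (Q3 + Q4))) ^ 2 := by
    rw [hC]; ring
  -- the four terms
  have hu2 : (fnn * P1 ^ 2) ^ 2 ≤ fnn ^ 2 * δ ^ 2 * P1 ^ 2 := by
    have e1 : (fnn * P1 ^ 2) ^ 2 = (fnn * P1) ^ 2 * P1 ^ 2 := by ring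
    have e2 : fnn ^ 2 * δ ^ 2 * P1 ^ 2 = (fnn * P1) ^ 2 * δ ^ 2 := by ring
    rw [e1, e2]
    exact mul_le_mul_of_nonneg_left p1 (sq_nonneg _)
  have hv2 : (fnn * (P1 * Q1 + P2 * Q2 + P3 * Q3 + P4 * Q4)) ^ 2
      ≤ fnn ^ 2 * (4 * δ ^ 2 * (Q1 ^ 2 + Q2 ^ 2 + Q3 ^ 2 + Q4 ^ 2)) :=
    sq_mul_le fnn (termV_le δ P1 P2 P3 P4 Q1 Q2 Q3 Q4 p1 p2 p3 p4)
  have hw2 : (ξ * (Fc * P2 + Fb * Q1)) ^ 2 ≤ ξ ^ 2 * (2 * M ^ 2 * (P2 ^ 2 + Q1 ^ 2)) :=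
    sq_mul_le ξ (termW_le M Fb Fc P2 Q1 fb fc)
  have hz2 : (ζ * (Fc * (P3 + P4) + Fb * (Q3 + Q4))) ^ 2
      ≤ ζ ^ 2 * (4 * M ^ 2 * (P3 ^ 2 + P4 ^ 2 + Q3 ^ 2 + Q4 ^ 2)) :=
    sq_mul_le ζ (termZ_le M Fb Fc P3 P4 Q3 Q4 fb fc)
  rw [e, neg_sq] at *
  rw [e]
  linarith

/-- ★ POINTWISE BOUND off the window: with `pᵢ = D_{eᵢ} f(b)`, `qᵢ = D_{eᵢ} f(b − x̂)` (`e = x̂, −x̂, ŷ, −ŷ`),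
`C0(x̂,b)² ≤ f_nn²δ²p₁² + 4f_nn²δ²Σqᵢ² + 2ξ²M²(p₂² + q₁²) + 4ζ²M²(p₃² + p₄² + q₃² + q₄²)`. [folklore] -/
theorem c0_sq_pointwise (hL : 3 ≤ L) {Δ lam2 M δ : ℝ} {f : Tor L → ℝ} (hf : IsTwoMagnon L Δ lam2 f)
    (heven : ∀ r : Tor L, f (-r) = f r) (hmi : ∀ r : Tor L, f (-r.1, r.2) = f r)
    (hM : ∀ r : Tor L, |f r| ≤ M)
    (hδ : ∀ e ∈ nnList L, ∀ b : Tor L, b ≠ 0 → b - e ≠ 0 → |Dgrad L f e b| ≤ δ)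
    {b : Tor L} (hb : b ∈ (((Finset.univ : Finset (Tor L)).erase 0).erase (ex L)) \ shellWin L) :
    C0fn L Δ lam2 f (ex L, b) ^ 2
      ≤ f (ex L) ^ 2 * δ ^ 2 * Dgrad L f (ex L) b ^ 2
        + 4 * f (ex L) ^ 2 * δ ^ 2 * (Dgrad L f (ex L) (b - ex L) ^ 2 + Dgrad L f (-ex L) (b - ex L) ^ 2
            + Dgrad L f (ey L) (b - ex L) ^ 2 + Dgrad L f (-ey L) (b - ex L) ^ 2)
        + 2 * xiW L f ^ 2 * M ^ 2 * (Dgrad L f (-ex L) b ^ 2 + Dgrad L f (ex L) (b - ex L) ^ 2)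
        + 4 * zetaW L f ^ 2 * M ^ 2 * (Dgrad L f (ey L) b ^ 2 + Dgrad L f (-ey L) b ^ 2
            + Dgrad L f (ey L) (b - ex L) ^ 2 + Dgrad L f (-ey L) (b - ex L) ^ 2) := by
  obtain ⟨hb0, hb1, hb2, hb3, hb4, -, -, -⟩ := mem_bulk L hb
  have mx : ex L ∈ nnList L := by unfold nnList ex; simp
  have mnx : -ex L ∈ nnList L := by rw [← neg_ex]; unfold nnList; simp
  have my : ey L ∈ nnList L := by unfold nnList ey; simp
  have mny : -ey L ∈ nnList L := by rw [← neg_ey]; unfold nnList; simp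
  have p1 : Dgrad L f (ex L) b ^ 2 ≤ δ ^ 2 :=
    sq_le_sq_of_abs_le (hδ _ mx b hb0 (sub_ne_zero.mpr hb1))
  have p2 : Dgrad L f (-ex L) b ^ 2 ≤ δ ^ 2 :=
    sq_le_sq_of_abs_le (hδ _ mnx b hb0 (by rw [sub_neg_eq_add]; intro h; exact hb2 (by
      rw [← sub_eq_zero, sub_neg_eq_add]; exact h)))
  have p3 : Dgrad L f (ey L) b ^ 2 ≤ δ ^ 2 :=
    sq_le_sq_of_abs_le (hδ _ my b hb0 (sub_ne_zero.mpr hb3))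
  have p4 : Dgrad L f (-ey L) b ^ 2 ≤ δ ^ 2 :=
    sq_le_sq_of_abs_le (hδ _ mny b hb0 (by rw [sub_neg_eq_add]; intro h; exact hb4 (by
      rw [← sub_eq_zero, sub_neg_eq_add]; exact h)))
  have fb : f b ^ 2 ≤ M ^ 2 := sq_le_sq_of_abs_le (hM b)
  have fc : f (b - ex L) ^ 2 ≤ M ^ 2 := sq_le_sq_of_abs_le (hM (b - ex L))
  exact pointwise_alg _ _ _ _ _ _ _ _ _ _ _ _ _ _ _ _ (c0_shell_PQRT L hL hf heven hmi b hb0 hb1) p1 p2 p3 p4 fb fc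

/-! ## §5 Summation over the bulk -/

/-- ★ THE CRUDE SHELL BOUND (body of `ShellBulkBound L Δ`, `L ≥ 3`). [folklore] -/
theorem shell_bulk_bound (hL : 3 ≤ L) {Δ lam2 M δ : ℝ} {f : Tor L → ℝ} (hf : IsTwoMagnon L Δ lam2 f)
    (heven : ∀ r : Tor L, f (-r) = f r) (hsw : ∀ r : Tor L, f (r.2, r.1) = f r)
    (hmi : ∀ r : Tor L, f (-r.1, r.2) = f r) (hM : ∀ r : Tor L, |f r| ≤ M)
    (hδ : ∀ e ∈ nnList L, ∀ b : Tor L, b ≠ 0 → b - e ≠ 0 → |Dgrad L f e b| ≤ δ) :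
    (∑ b ∈ (((Finset.univ : Finset (Tor L)).erase 0).erase (ex L)) \ shellWin L, C0fn L Δ lam2 f (ex L, b) ^ 2)
      ≤ (17 * f (ex L) ^ 2 * δ ^ 2 + 8 * xiW L f ^ 2 * M ^ 2 + 16 * zetaW L f ^ 2 * M ^ 2) * gradNormSq L Δ f := by
  set B := (((Finset.univ : Finset (Tor L)).erase 0).erase (ex L)) \ shellWin L with hB
  -- pointwise
  have hpt := fun b (hb : b ∈ B) => c0_sq_pointwise L hL hf heven hmi hM hδ hb
  refine (Finset.sum_le_sum hpt).trans ?_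
  -- the eight partial gradient sums are `≤ τ̄`
  have hx : ex L = ex L ∨ ex L = -ex L ∨ ex L = ey L ∨ ex L = -ey L := Or.inl rfl
  have hnx : -ex L = ex L ∨ -ex L = -ex L ∨ -ex L = ey L ∨ -ex L = -ey L := Or.inr (Or.inl rfl)
  have hy : ey L = ex L ∨ ey L = -ex L ∨ ey L = ey L ∨ ey L = -ey L := Or.inr (Or.inr (Or.inl rfl))
  have hny : -ey L = ex L ∨ -ey L = -ex L ∨ -ey L = ey L ∨ -ey L = -ey L := Or.inr (Or.inr (Or.inr rfl))
  have nb : ∀ b ∈ B, b ≠ 0 ∧ b ≠ ex L ∧ b ≠ -ex L ∧ b ≠ ey L ∧ b ≠ -ey L ∧ b ≠ ex L + ex L ∧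
      b ≠ ex L + ey L ∧ b ≠ ex L - ey L := fun b hb => mem_bulk L hb
  have sP1 : ∑ b ∈ B, Dgrad L f (ex L) b ^ 2 ≤ gradNormSq L Δ f :=
    sum_Dgrad_sq_le L Δ hsw hx B fun b hb => ⟨(nb b hb).1, sub_ne_zero.mpr (nb b hb).2.1⟩
  have sP2 : ∑ b ∈ B, Dgrad L f (-ex L) b ^ 2 ≤ gradNormSq L Δ f :=
    sum_Dgrad_sq_le L Δ hsw hnx B fun b hb => ⟨(nb b hb).1, by
      rw [sub_neg_eq_add]; intro h
      exact (nb b hb).2.2.1 (by rw [← sub_eq_zero, sub_neg_eq_add]; exact h)⟩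
  have sP3 : ∑ b ∈ B, Dgrad L f (ey L) b ^ 2 ≤ gradNormSq L Δ f :=
    sum_Dgrad_sq_le L Δ hsw hy B fun b hb => ⟨(nb b hb).1, sub_ne_zero.mpr (nb b hb).2.2.2.1⟩
  have sP4 : ∑ b ∈ B, Dgrad L f (-ey L) b ^ 2 ≤ gradNormSq L Δ f :=
    sum_Dgrad_sq_le L Δ hsw hny B fun b hb => ⟨(nb b hb).1, by
      rw [sub_neg_eq_add]; intro h
      exact (nb b hb).2.2.2.2.1 (by rw [← sub_eq_zero, sub_neg_eq_add]; exact h)⟩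
  have sQ1 : ∑ b ∈ B, Dgrad L f (ex L) (b - ex L) ^ 2 ≤ gradNormSq L Δ f :=
    sum_Dgrad_sq_shift_le L Δ hsw hx B fun b hb => ⟨sub_ne_zero.mpr (nb b hb).2.1, by
      rw [sub_sub]; exact sub_ne_zero.mpr (nb b hb).2.2.2.2.2.1⟩
  have sQ2 : ∑ b ∈ B, Dgrad L f (-ex L) (b - ex L) ^ 2 ≤ gradNormSq L Δ f :=
    sum_Dgrad_sq_shift_le L Δ hsw hnx B fun b hb => ⟨sub_ne_zero.mpr (nb b hb).2.1, by
      rw [sub_neg_eq_add, sub_add_cancel]; exact (nb b hb).1⟩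
  have sQ3 : ∑ b ∈ B, Dgrad L f (ey L) (b - ex L) ^ 2 ≤ gradNormSq L Δ f :=
    sum_Dgrad_sq_shift_le L Δ hsw hy B fun b hb => ⟨sub_ne_zero.mpr (nb b hb).2.1, by
      rw [sub_sub]; exact sub_ne_zero.mpr (nb b hb).2.2.2.2.2.2.1⟩
  have sQ4 : ∑ b ∈ B, Dgrad L f (-ey L) (b - ex L) ^ 2 ≤ gradNormSq L Δ f :=
    sum_Dgrad_sq_shift_le L Δ hsw hny B fun b hb => ⟨sub_ne_zero.mpr (nb b hb).2.1, by
      rw [sub_sub, ← sub_eq_add_neg]; exact sub_ne_zero.mpr (nb b hb).2.2.2.2.2.2.2⟩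
  -- collect
  simp only [Finset.sum_add_distrib, ← Finset.mul_sum, mul_add]
  have c1 : 0 ≤ f (ex L) ^ 2 * δ ^ 2 := by positivity
  have c2 : 0 ≤ xiW L f ^ 2 * M ^ 2 := by positivity
  have c3 : 0 ≤ zetaW L f ^ 2 * M ^ 2 := by positivity
  have hτ : 0 ≤ gradNormSq L Δ f := by rw [gradNormSq_eq]; positivity
  have t1 := mul_le_mul_of_nonneg_left sP1 c1
  have t2 := mul_le_mul_of_nonneg_left sQ1 c1
  have t3 := mul_le_mul_of_nonneg_left sQ2 c1
  have t4 := mul_le_mul_of_nonneg_left sQ3 c1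
  have t5 := mul_le_mul_of_nonneg_left sQ4 c1
  have t6 := mul_le_mul_of_nonneg_left sP2 c2
  have t7 := mul_le_mul_of_nonneg_left sQ1 c2
  have t8 := mul_le_mul_of_nonneg_left sP3 c3
  have t9 := mul_le_mul_of_nonneg_left sP4 c3
  have t10 := mul_le_mul_of_nonneg_left sQ3 c3
  have t11 := mul_le_mul_of_nonneg_left sQ4 c3
  nlinarith [mul_nonneg c2 hτ]

end ShellRow

/-- ★ **`ShellBulkBound L Δ` holds for `L ≥ 3`.** [folklore] -/
theorem shellBulkBound_holds (hL : 3 ≤ L) (Δ : ℝ) : ShellBulkBound L Δ :=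
  fun _ _ _ _ hf heven hsw hmi hM hδ _ => ShellRow.shell_bulk_bound L hL hf heven hsw hmi hM hδ

end Summit.HubbardSuperconductivity.HubbardSuperconductivity.Theorems.AnisotropyChord.Transfer.Fibre3

end
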